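import Summits.Schanuel.Schanuel.Theorems.RootDecomp1KArcCell11

/-!
# RootDecomp1KArcCell — lens 1, generation 50, node 9 «THE ARC ENGINE: separation by positive-dimensional containment; members ρ° = Π(1+4^(−k!)) and the twin σ° = Π(1+2·4^(−k!)); item 33364 decided hyp-free at zA = (1, ℓ₂, ρ°), zD = (1, ρ°, σ°) and π-twins» — continuation (RootDecomp1KArcCell12): §12a part 1 the archimedean two-level cut

(lens-1 g50 HOME kernel K = HOME/decomp-schanuel-lens-1/g50/ArcCell.lean 10f1e0d5…, 3410 l · 258 decl lines, imports …RootDecomp1KCollarWall05 + …RootDecomp1KCommonRadixCell04 + …RootDecomp1KNWMeasureHolds BY NAME; P ArcCellProbe.lean af7624ff… rc 0 / C₀ ArcCellCtrl0.lean d71f613e… rc 0 / C ArcCellCtrl.lean 242a3b02… rc 1 = 42 planted; memo NODE-g50.md; CLAIM L2466, EX-ANTE PRICE + CHECKLIST K-g50 L2467, NODE L2469 / REQUEST L2470 (with the lens's ex-post self-correction: both members fall to printed dominance in substance — zA directly by Bundschuh LNM 1415 p.78 / Zhu 推论 1.3.3, zD after τ = σ°/ρ°²); critic VERDICT L2473: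 CLEARED AS PRICED EX ANTE — ONE CELL ×1 «ARC CELL (TYPED-LEVEL)» with the SUBSTANCE CAVEAT OF RECORD (both members inside the archimedean dominance class in substance; E2 convenient, not necessary), RULE K-R39 FIXED, PORT GO. Port by census-1 gen 21 as `RootDecomp1KArcCell01–13` along K's §1–§12 with §4, §7 and §12 cut at decl boundaries by the 400-line file cap: 01 = §1 (E1) `aeval_one_div_two_pow_ne_zero` (dyadic root lemma) + §2 (E2) `toPolyPoly`, `arc_count` (a relation contains ≤ deg q of an injective family of rational arcs — roots over the domain ℚ[X]); 02 = §3 (A) the member: `dfac`, `arcNum`, `arcProdQ` (ρ°_N), `sQ`, `rhoArc` (ρ° = Π(1 + 4^(−k!))) and its tails; 03 = §4a (E3) `TruncGenericSeq` («[class] definition» tag) + **`algebraicIndependent_of_truncGenericSeq`** (the g36/g37 extraction re-plumbed to arbitrary dyadic-type schedules); 04 = §4b `psQ`, the link `truncGeneric_iff_truncGenericSeq` and the tree (X′) re-derived — K's `theorem algebraicIndependent_liouville_of_truncGeneric'` DEMOTED to a documented `example` (its statement is byte-identical to the tree's `RootDecomp1KCommonRadixCell.algebraicIndependent_liouville_of_truncGeneric`,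 CommonRadixCell03 l.98 — dedup twin flagged by the writer L2472 (α), demotion pre-sanctioned by the critic L2473; nothing in K uses the primed name); 05 = §5 the arcs of ρ°: `arcPoly`, `arcF`, `arcBasis`, `arcScal`, `clearArc`, `truncGenericSeq_arc`, tightness `qArc` / `qArc_tight`; 06 = §6 the arc cell `algebraicIndependent_arc_of_mvPolyMeasure`, `algebraicIndependent_rhoArc_ell2`, walls `sb_arcWall3(_pi)`, item-shape instances + §7 head `zA` / `zApi`, `linearIndependent_zA(pi)`, `linLiouville_zA(pi)`; 07 = §7a the ONE 2-adic cut `cutA` + **`form_lower_bound_A`** (exponent 9), `not_hyperLinLiouville_zA(pi)` (m₀ = 10), `sb_zA(pi)`, `finiteOrderLiouvilleSchanuel_at_zA(pi)`, `item33364_at_zA(pi)`, `item31077_at_zA`; 08 = §8 `rhoArc_position` (11 conjuncts by tree name) and its lemmas, `liouville_rhoArc`; 09 = §9 (A′) the twin σ° = Π(1 + 2·4^(−k!)): `arcNum2`, `arcOdd2`, `arcProdQ2`, `sigmaArc`, `liouville_sigmaArc`; 10 = §10 the lines of (ρ°, σ°): `linPoly`, `linF`, `linBasis`, `linScal`, `clearLin`,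 `truncGenericSeq_lin`, `qLin` / `qLin_tight`; 11 = §11 the twin cell `algebraicIndependent_twin_of_mvPolyMeasure`, walls `sb_twinWall3(_pi)`, item-shape instances + §12 head `zD` / `zDpi`, binders; 12 = §12a part 1 the archimedean two-level cut `cutD`, `cutD_succ_ne_zero`, `cutD_height_bound`; 13 = §12a part 2 **`form_lower_bound_D`** (exponent 7), `not_hyperLinLiouville_zD(pi)` (m₀ = 8), `sb_zD(pi)`, `item33364_at_zD(pi)`, `zD_shape`. PORT EDITS (census convention): `set_option linter.dupNamespace false` dropped; 77 one-line helper docstrings added (statements quoted); per-part private helper copies; sections `Extraction` / `Members` / `TwinMembers` closed and re-opened across the cuts with their `variable` / `open` lines; statements and proofs otherwise verbatim (no renames; K's own private markers kept). `--supports stmt-Schanuel-33364`; no census credit carried; rung 0 — nothing here proves Schanuel; no ∀-item moves; 33364, 33363, 31077 stay OPEN.)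
-/

noncomputable section

open Polynomial LiouvilleNumber
open scoped Nat

namespace Summit.Schanuel.Schanuel.Theorems.RootDecomp1KArcCell

open Summit.Schanuel.Schanuel.Theorems.RootDecomp1KCollarCell
open Summit.Schanuel.Schanuel.Theorems.RootDecomp1KGapCell
open Summit.Schanuel.Schanuel.Theorems.RootDecomp1KTwoBaseCell
open Summit.Schanuel.Schanuel.Theorems.RootDecomp1KRelLiouvilleCell
open Summit.Schanuel.Schanuel.Theorems.RootDecomp1KNWMeasureHolds (polyMeasure_exp_one_holds)
open Summit.Schanuel.Schanuel.Theorems.RootDecomp1KHyper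
open Summit.Schanuel.Schanuel.Theorems.RootDecomp1KHyper.HyperCell
open Summit.Schanuel.Schanuel.Theorems.RootDecomp1KCommonRadixCell (TruncGeneric algebraicIndependent_liouville_of_truncGeneric)

section TwinMembers

open IntermediateField

/-! ### §12a  the archimedean TWO-LEVEL cut and the form lower bound (M′) -/

/-- The cut integer `J_M(g) = g₀·4^{D_M} + g₁·arcNum M + g₂·arcNum2 M`. -/
def cutD (g : Fin 3 → ℤ) (M : ℕ) : ℤ :=
  g 0 * 4 ^ dfac M + g 1 * (arcNum M : ℤ) + g 2 * (arcNum2 M : ℤ)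

/-- THE TWO-LEVEL IDENTITY: `J_{N+1} = 4^{(N+1)!}·J_N + (g₁·arcNum N + 2g₂·arcNum2 N)`. -/
theorem cutD_succ (g : Fin 3 → ℤ) (N : ℕ) :
    cutD g (N + 1) = 4 ^ (N + 1)! * cutD g N + (g 1 * (arcNum N : ℤ) + 2 * g 2 * (arcNum2 N : ℤ)) := by
  rw [cutD, cutD, arcNum_succ, arcNum2_succ, dfac_succ, pow_add]
  push_cast
  ring

/-- `(N : ℕ) : ((arcProdQ2 N : ℚ) : ℝ) = (arcNum2 N : ℝ) / (2 : ℝ) ^ (2 * dfac N)`. -/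
private theorem arcProdQ2_cast_eq (N : ℕ) : ((arcProdQ2 N : ℚ) : ℝ) = (arcNum2 N : ℝ) / (2 : ℝ) ^ (2 * dfac N) := by
  rw [arcProdQ2_eq_div, pow_mul]
  push_cast
  norm_num

/-- The cut is the rational `J_M(g)/4^{D_M}`: `g₀ + g₁ ρ°_M + g₂ σ°_M = J_M(g)/2^{2D_M}`. -/
theorem cutD_eq (g : Fin 3 → ℤ) (M : ℕ) :
    (g 0 : ℝ) + g 1 * ((arcProdQ M : ℚ) : ℝ) + g 2 * ((arcProdQ2 M : ℚ) : ℝ) =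
      (cutD g M : ℝ) / (2 : ℝ) ^ (2 * dfac M) := by
  rw [arcProdQ_cast_eq, arcProdQ2_cast_eq, cutD, pow_mul]
  push_cast
  field_simp
  norm_num

/-- Integer bounds for the numerators: `arcNum N ≤ 3·4^{D_N}`, `arcNum2 N ≤ 5·4^{D_N}`. -/
theorem arcNum_le (N : ℕ) : arcNum N ≤ 3 * 4 ^ dfac N := by
  have h := arcProdQ_lt_three' N
  rw [arcProdQ_eq_div, div_lt_iff₀ (by positivity)] at h
  exact_mod_cast h.le

/-- `(N : ℕ) : arcNum2 N ≤ 5 * 4 ^ dfac N`. -/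
theorem arcNum2_le (N : ℕ) : arcNum2 N ≤ 5 * 4 ^ dfac N := by
  have h := arcProdQ2_lt_five' N
  rw [arcProdQ2_eq_div, div_lt_iff₀ (by positivity)] at h
  exact_mod_cast h.le

/-- The gap slack for the two-level identity: `4 + N! + 2D_N ≤ 2(N+1)!` for `N ≥ 3`. -/
theorem cutD_gap_slack {N : ℕ} (hN : 3 ≤ N) : 4 + N ! + 2 * dfac N ≤ 2 * (N + 1)! := by
  have hD := dfac_le N
  have h6 : 6 ≤ N ! := (Nat.factorial_le hN).trans' (by norm_num [Nat.factorial])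
  have h8 : 8 * N ! ≤ 2 * (N + 1)! := by
    rw [Nat.factorial_succ]; nlinarith
  omega

/-- `2D_N − N − 1 ≥ N!` in the form `N! + N + 1 ≤ 2 D_N` (`D_N ≥ N!` and `D_N ≥ N + 1`). -/
theorem factorial_add_le_two_dfac (N : ℕ) : N ! + N + 1 ≤ 2 * dfac N := by
  have h1 := factorial_le_dfac N
  have h2 : N + 1 ≤ dfac N := by
    unfold dfac
    calc N + 1 = ∑ k ∈ Finset.range (N + 1), 1 := by simp
      _ ≤ ∑ k ∈ Finset.range (N + 1), k ! := Finset.sum_le_sum fun k _ => Nat.factorial_pos k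
  omega

/-- **`J_{N+1}(g) ≠ 0`** whenever `g ≠ 0`, `N ≥ 3` and `|g₁|, |g₂| < 2^{N!}` — the archimedean two-level argument plus the top-level
2-adic factor `arcNum2 N = 2^{N+1}·odd`. -/
theorem cutD_succ_ne_zero (g : Fin 3 → ℤ) {N : ℕ} (hN : 3 ≤ N) (hg : g ≠ 0) (h1 : |g 1| < 2 ^ N !)
    (h2 : |g 2| < 2 ^ N !) : cutD g (N + 1) ≠ 0 := by
  intro h0
  rw [cutD_succ] at h0
  set X : ℤ := cutD g N with hX
  set Y : ℤ := g 1 * (arcNum N : ℤ) + 2 * g 2 * (arcNum2 N : ℤ) with hY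
  -- `|Y| < 4^{(N+1)!}`
  have hr := arcNum_le N
  have hp := arcNum2_le N
  have hslack := cutD_gap_slack hN
  have hYlt : |Y| < (4 : ℤ) ^ (N + 1)! := by
    have hY1 : |Y| ≤ |g 1| * (arcNum N : ℤ) + 2 * |g 2| * (arcNum2 N : ℤ) := by
      rw [hY]
      refine (abs_add_le _ _).trans ?_
      rw [abs_mul, abs_mul, abs_mul, Nat.abs_cast, Nat.abs_cast, abs_two]
    have hY2 : |g 1| * (arcNum N : ℤ) + 2 * |g 2| * (arcNum2 N : ℤ) ≤
        ((2 : ℤ) ^ N ! + (-1)) * (3 * 4 ^ dfac N) + 2 * ((2 : ℤ) ^ N ! + (-1)) * (5 * 4 ^ dfac N) := by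
      have hr' : (arcNum N : ℤ) ≤ 3 * 4 ^ dfac N := by exact_mod_cast hr
      have hp' : (arcNum2 N : ℤ) ≤ 5 * 4 ^ dfac N := by exact_mod_cast hp
      have ha1 : |g 1| ≤ (2 : ℤ) ^ N ! + (-1) := by omega
      have ha2 : |g 2| ≤ (2 : ℤ) ^ N ! + (-1) := by omega
      have hnn : (0 : ℤ) ≤ (2 : ℤ) ^ N ! + (-1) := by linarith [abs_nonneg (g 1)]
      have h4nn : (0 : ℤ) ≤ 4 ^ dfac N := by positivity
      have hrnn : (0 : ℤ) ≤ (arcNum N : ℤ) := by positivity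
      have hpnn : (0 : ℤ) ≤ (arcNum2 N : ℤ) := by positivity
      have t1 : |g 1| * (arcNum N : ℤ) ≤ ((2 : ℤ) ^ N ! + (-1)) * (3 * 4 ^ dfac N) :=
        mul_le_mul ha1 hr' hrnn hnn
      have t2 : 2 * |g 2| * (arcNum2 N : ℤ) ≤ 2 * ((2 : ℤ) ^ N ! + (-1)) * (5 * 4 ^ dfac N) :=
        mul_le_mul (by linarith) hp' hpnn (by linarith)
      linarith
    have hY3 : ((2 : ℤ) ^ N ! + (-1)) * (3 * 4 ^ dfac N) + 2 * ((2 : ℤ) ^ N ! + (-1)) * (5 * (4 : ℤ) ^ dfac N) <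
        13 * (2 ^ N ! * 4 ^ dfac N) := by
      have : (0 : ℤ) < 4 ^ dfac N := by positivity
      nlinarith
    have hY4 : 13 * ((2 : ℤ) ^ N ! * 4 ^ dfac N) ≤ 4 ^ (N + 1)! := by
      have e1 : (13 : ℤ) * (2 ^ N ! * 4 ^ dfac N) ≤ 2 ^ 4 * (2 ^ N ! * 4 ^ dfac N) := by
        have : (0 : ℤ) < 2 ^ N ! * 4 ^ dfac N := by positivity
        nlinarith
      refine e1.trans ?_
      rw [show (4 : ℤ) = 2 ^ 2 by norm_num, ← pow_mul, ← pow_mul, ← pow_add, ← pow_add]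
      exact pow_le_pow_right₀ (by norm_num) (by omega)
    linarith
  -- hence `X = 0` and `Y = 0`
  have hX0 : X = 0 := by
    by_contra hx
    have h1X : (4 : ℤ) ^ (N + 1)! ≤ |4 ^ (N + 1)! * X| := by
      rw [abs_mul, abs_of_pos (by positivity : (0 : ℤ) < 4 ^ (N + 1)!)]
      exact le_mul_of_one_le_right (by positivity) (Int.one_le_abs hx)
    have : 4 ^ (N + 1)! * X = -Y := by linarith
    rw [this, abs_neg] at h1X
    linarith
  have hY0 : Y = 0 := by rw [hX0, mul_zero, zero_add] at h0; exact h0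
  -- `g₀·4^{D_N} = g₂·arcNum2 N`
  have hXdef : g 0 * 4 ^ dfac N + g 1 * (arcNum N : ℤ) + g 2 * (arcNum2 N : ℤ) = 0 := by
    rw [← hX0, hX, cutD]
  have hkey : g 0 * 4 ^ dfac N = g 2 * (arcNum2 N : ℤ) := by linarith
  -- divisibility: `2^{2D_N} ∣ g₂ · 2^{N+1} · arcOdd2 N`, so `2^{2D_N − (N+1)} ∣ g₂`
  have hfac : (arcNum2 N : ℤ) = 2 ^ (N + 1) * (arcOdd2 N : ℤ) := by exact_mod_cast arcNum2_eq N
  obtain ⟨t, ht⟩ : ∃ t, 2 * dfac N = (N + 1) + t := ⟨2 * dfac N - (N + 1), by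
    have := factorial_add_le_two_dfac N; omega⟩
  have htN : N ! ≤ t := by have := factorial_add_le_two_dfac N; omega
  have hdvd : (2 : ℤ) ^ t ∣ g 2 := by
    have h4 : (4 : ℤ) ^ dfac N = 2 ^ (N + 1) * 2 ^ t := by
      rw [show (4 : ℤ) = 2 ^ 2 by norm_num, ← pow_mul, ← pow_add, ht]
    have hd1 : (2 : ℤ) ^ (N + 1) * 2 ^ t ∣ 2 ^ (N + 1) * (g 2 * (arcOdd2 N : ℤ)) := by
      refine ⟨g 0, ?_⟩
      have : g 2 * (arcNum2 N : ℤ) = g 0 * 4 ^ dfac N := hkey.symm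
      rw [hfac] at this
      calc (2 : ℤ) ^ (N + 1) * (g 2 * (arcOdd2 N : ℤ)) = g 2 * (2 ^ (N + 1) * (arcOdd2 N : ℤ)) := by ring
        _ = g 0 * 4 ^ dfac N := this
        _ = 2 ^ (N + 1) * 2 ^ t * g 0 := by rw [h4]; ring
    have hd2 : (2 : ℤ) ^ t ∣ g 2 * (arcOdd2 N : ℤ) :=
      (mul_dvd_mul_iff_left (by positivity : (2 : ℤ) ^ (N + 1) ≠ 0)).mp hd1
    have hcop : IsCoprime ((2 : ℤ) ^ t) (arcOdd2 N : ℤ) := by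
      have h := (Nat.isCoprime_iff_coprime.mpr (Nat.coprime_two_left.mpr (odd_arcOdd2 N))).pow_left (m := t)
      exact_mod_cast h
    exact hcop.dvd_of_dvd_mul_right hd2
  -- so `g₂ = 0` (else `|g₂| ≥ 2^t ≥ 2^{N!}`), then `g₀ = 0`, `g₁ = 0`
  have hg2 : g 2 = 0 := by
    by_contra hne
    have hle : (2 : ℤ) ^ t ≤ |g 2| := Int.le_of_dvd (abs_pos.mpr hne) ((dvd_abs _ _).mpr hdvd)
    have : (2 : ℤ) ^ N ! ≤ 2 ^ t := pow_le_pow_right₀ (by norm_num) htN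
    linarith
  have hg0 : g 0 = 0 := by
    rw [hg2, zero_mul] at hkey
    rcases mul_eq_zero.mp hkey with h | h
    · exact h
    · exact absurd h (by positivity)
  have hg1 : g 1 = 0 := by
    rw [hY, hg2] at hY0
    have : g 1 * (arcNum N : ℤ) = 0 := by linarith
    rcases mul_eq_zero.mp this with h | h
    · exact h
    · exact absurd h (by have := (odd_arcNum N).pos; positivity)
  apply hg
  funext i; fin_cases i
  · exact hg0
  · exact hg1
  · exact hg2

/-- A non-vanishing cut is `≥` its resolution. -/
theorem cutD_lower (g : Fin 3 → ℤ) (M : ℕ) (hne : cutD g M ≠ 0) :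
    1 / (2 : ℝ) ^ (2 * dfac M) ≤ |(g 0 : ℝ) + g 1 * ((arcProdQ M : ℚ) : ℝ) + g 2 * ((arcProdQ2 M : ℚ) : ℝ)| := by
  rw [cutD_eq, abs_div, abs_of_pos (by positivity : (0 : ℝ) < 2 ^ (2 * dfac M))]
  exact div_le_div_of_nonneg_right (by exact_mod_cast Int.one_le_abs hne) (by positivity)

/-- The cut's truncation error: `≤ |g₁|·8/4^{(M+1)!} + |g₂|·36/4^{(M+1)!}`. -/
theorem cutD_approx (g : Fin 3 → ℤ) (M : ℕ) :
    |((g 0 : ℝ) + g 1 * rhoArc + g 2 * sigmaArc) -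
      ((g 0 : ℝ) + g 1 * ((arcProdQ M : ℚ) : ℝ) + g 2 * ((arcProdQ2 M : ℚ) : ℝ))| ≤
      |(g 1 : ℝ)| * (8 / (4 : ℝ) ^ (M + 1)!) + |(g 2 : ℝ)| * (36 / (4 : ℝ) ^ (M + 1)!) := by
  have hρ : |rhoArc - arcProdQ M| ≤ 8 / (4 : ℝ) ^ (M + 1)! := by
    rw [abs_of_pos (by linarith [arcProdQ_lt_rhoArc M])]; exact rhoArc_sub_arcProdQ_le M
  have hσ : |sigmaArc - arcProdQ2 M| ≤ 36 / (4 : ℝ) ^ (M + 1)! := by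
    rw [abs_of_pos (by linarith [arcProdQ2_lt_sigmaArc M])]; exact sigmaArc_sub_arcProdQ2_le M
  have e : ((g 0 : ℝ) + g 1 * rhoArc + g 2 * sigmaArc) -
      ((g 0 : ℝ) + g 1 * ((arcProdQ M : ℚ) : ℝ) + g 2 * ((arcProdQ2 M : ℚ) : ℝ)) =
      g 1 * (rhoArc - arcProdQ M) + g 2 * (sigmaArc - arcProdQ2 M) := by ring
  rw [e]
  calc |(g 1 : ℝ) * (rhoArc - arcProdQ M) + g 2 * (sigmaArc - arcProdQ2 M)|
      ≤ |(g 1 : ℝ)| * |rhoArc - arcProdQ M| + |(g 2 : ℝ)| * |sigmaArc - arcProdQ2 M| := by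
        refine (abs_add_le _ _).trans ?_
        rw [abs_mul, abs_mul]
    _ ≤ |(g 1 : ℝ)| * (8 / (4 : ℝ) ^ (M + 1)!) + |(g 2 : ℝ)| * (36 / (4 : ℝ) ^ (M + 1)!) := by
        gcongr

/-- **The cut slack**: `7 + N! + 2D_{N+1} ≤ 2(N+2)!` for `N ≥ 2`. -/
theorem cutD_slack {N : ℕ} (hN : 2 ≤ N) : 7 + N ! + 2 * dfac (N + 1) ≤ 2 * (N + 2)! := by
  have hD := dfac_le (N + 1)
  have h2 : 2 ≤ N ! := (Nat.factorial_le hN).trans' (by norm_num [Nat.factorial])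
  have hf1 : (N + 1)! = (N + 1) * N ! := Nat.factorial_succ N
  have hf2 : (N + 2)! = (N + 2) * (N + 1)! := Nat.factorial_succ (N + 1)
  have h3 : 3 * N ! ≤ (N + 1)! := by rw [hf1]; nlinarith
  have h4 : 4 * (N + 1)! ≤ (N + 2)! := by rw [hf2]; nlinarith
  omega

/-- **Minimality of the cut level bounds the resolution by the height**: if `3 ≤ N` and `2^{k!} ≤ H` for every `3 ≤ k < N` then
`2D_{N+1} + 2 ≤ (1+H)^7` — floor `N = 3`: `2·D_4 + 2 = 70 ≤ 2^7`; `N = M+1 ≥ 4`: `M! < 2^{M!} ≤ H`, `M + 2 ≤ M! < H`, so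
`2D_{M+2} + 2 ≤ 4(M+2)(M+1)·M! + 2 ≤ 4H³ + 2 ≤ (1+H)^4`. -/
theorem cutD_height_bound {H N : ℕ} (hH : 1 ≤ H) (hN : 3 ≤ N) (hmin : ∀ k < N, 3 ≤ k → 2 ^ k ! ≤ H) :
    2 * dfac (N + 1) + 2 ≤ (1 + H) ^ 7 := by
  have X2 : 2 ≤ 1 + H := by omega
  rcases Nat.eq_or_lt_of_le hN with h3 | h4
  · subst h3
    have hD : dfac 4 = 34 := by norm_num [dfac, Finset.sum_range_succ, Nat.factorial]
    have h7 : 2 ^ 7 ≤ (1 + H) ^ 7 := Nat.pow_le_pow_left X2 7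
    rw [hD]
    norm_num at h7
    omega
  · obtain ⟨M, rfl⟩ : ∃ M, N = M + 1 := ⟨N - 1, by omega⟩
    have hM3 : 3 ≤ M := by omega
    have hm := hmin M (by omega) hM3
    have hfac : M ! < H := lt_of_lt_of_le Nat.lt_two_pow_self hm
    have h6 : 6 ≤ M ! := (Nat.factorial_le hM3).trans' (by norm_num [Nat.factorial])
    have hM2 : M + 2 ≤ M ! := by
      obtain ⟨j, rfl⟩ : ∃ j, M = j + 3 := ⟨M - 3, by omega⟩
      rw [Nat.factorial_succ]
      have : 2 ≤ (j + 2)! := (Nat.factorial_le (show 2 ≤ j + 2 by omega)).trans' (by norm_num [Nat.factorial])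
      nlinarith
    have hN_le : M + 2 ≤ H := by omega
    have hD := dfac_le (M + 1 + 1)
    have hfacN : (M + 1 + 1)! ≤ H * H * H := by
      rw [Nat.factorial_succ, Nat.factorial_succ]
      have a1 : M + 1 + 1 ≤ H := by omega
      have a2 : M + 1 ≤ H := by omega
      calc (M + 1 + 1) * ((M + 1) * M !) ≤ H * (H * H) :=
            Nat.mul_le_mul a1 (Nat.mul_le_mul a2 hfac.le)
        _ = H * H * H := by ring
    calc 2 * dfac (M + 1 + 1) + 2 ≤ 4 * (H * H * H) + 2 := by omega
      _ ≤ (1 + H) ^ 4 := by nlinarith [hH]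
      _ ≤ (1 + H) ^ 7 := Nat.pow_le_pow_right (by omega) (by norm_num)

end TwinMembers

end Summit.Schanuel.Schanuel.Theorems.RootDecomp1KArcCell

end
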